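import Literature.NumberTheory.EllipticCurves.LocalKummerIsotropyTransport
import Literature.NumberTheory.EllipticCurves.SelmerCorankProofs
import Literature.NumberTheory.LocalFields.EisensteinDumasCriterion
import Literature.NumberTheory.GaloisRepresentations.AbsGaloisGroup
import Mathlib.RingTheory.Polynomial.Eisenstein.IsIntegral
import Mathlib.RingTheory.Polynomial.Cyclotomic.Roots
import Mathlib.FieldTheory.Galois.Infinite
import HarnessLib

/-!
# TORS-TWIST, preliminaries (route `AdditiveKolyvaginRoad`, crux `ManinFrameResidueProperR` =
# stmt-BirchSwinnertonDyer-20709, line `tame_twist`, Kosters–Pannekoek sub-residue) — `--supports`, helper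

Cell `pub/bsd-wall`, seat `bsd-wall-manin-p1` (g6). THEOREMS ONLY (no definition, no named fact, no `sorry`);
route-free. Nothing is closed and BSD is not proved by this file. Consumed by the companion file
`AdditiveKolyvaginRoadManinFrameResidueProperRTorsTwist.lean` (the TORS-TWIST theorem itself):

* `irreducible_cyclotomic_padic` — `Φ_p` is irreducible over `ℚ_p` (Eisenstein at `p` for `Φ_p(X + 1)`,
  Mathlib `cyclotomic_comp_X_add_one_isEisensteinAt`, through the tree's `irreducible_map_padic_of_eisenstein`);
* `false_of_isPrimitiveRoot_of_forall_smul` — for `p ≥ 5` no primitive `p`-th root of unity `ζ ∈ ℚ̄_p` is moved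
  by `Γ_{ℚ_p}` only within `{ζ, ζ⁻¹}` (else `ζ + ζ⁻¹ ∈ ℚ_p` and `ζ` would be quadratic over `ℚ_p`);
* `exists_zsmul_add_zsmul_of_card_eq_sq` — two independent points span a group of order `p²`;
* `exists_geomTorsion_of_padicPoint`, `exists_geomTorsion_of_localPoint` — `ℚ_p`-rational / `ℚ̄_p`-valued
  `n`-torsion points of `W/ℚ` as geometric torsion points with their `Γ_{ℚ_p}`-action (`torsionPointsEquiv`,
  `pointsMap`, `resGal`; *AEC* III.6.4(b), VIII.§1).

References: J. H. Silverman, *AEC* (2009), III.6.4, VIII.§1 [SilvermanAEC2009]; J.-P. Serre, *Local Fields*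
(1979), IV.§4 Prop. 17 [SerreLocalFields1979]; F. Q. Gouvêa, *p-adic Numbers*, Thm. 6.3.11 [Gouvea1993PadicNumbers].
-/

set_option autoImplicit false
set_option linter.dupNamespace false

noncomputable section

open scoped Classical

open Polynomial WeierstrassCurve Field Literature.NumberTheory.EllipticCurves

namespace Summit.BirchSwinnertonDyer.BirchSwinnertonDyer.Theorems.TorsTwist

/-- **The `p`-th cyclotomic polynomial is irreducible over `ℚ_p`** (Eisenstein at `p` for
`Φ_p(X + 1)`, Mathlib `cyclotomic_comp_X_add_one_isEisensteinAt`, pushed through the tree's `p`-adic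
Eisenstein criterion `irreducible_map_padic_of_eisenstein`, and the substitution `X ↦ X + 1`).
[cite: Gouvea1993PadicNumbers, Thm. 6.3.11; SerreLocalFields1979, IV.§4 Prop. 17] -/
theorem irreducible_cyclotomic_padic (p : ℕ) [hp : Fact p.Prime] :
    Irreducible (cyclotomic p ℚ_[p]) := by
  have hE := cyclotomic_comp_X_add_one_isEisensteinAt p
  set f : ℤ[X] := (cyclotomic p ℤ).comp (X + 1) with hf
  have hmonic : f.Monic := by
    rw [hf, show (X + 1 : ℤ[X]) = X + C 1 by simp]
    exact (cyclotomic.monic p ℤ).comp (monic_X_add_C 1) fun h ↦ by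
      rw [natDegree_X_add_C] at h; exact one_ne_zero h
  have hdeg : f.natDegree = p - 1 := by
    rw [hf, natDegree_comp, natDegree_cyclotomic, Nat.totient_prime hp.out,
      show (X + 1 : ℤ[X]) = X + C 1 by simp, natDegree_X_add_C, mul_one]
  have hirr : Irreducible (f.map (Int.castRingHom ℚ_[p])) := by
    refine Literature.NumberTheory.LocalFields.irreducible_map_padic_of_eisenstein (p := p) hdeg
      (by have := hp.out.two_le; omega) ?_ (fun j hj ↦ ?_) ?_
    · rw [← hdeg, ← Polynomial.leadingCoeff, hmonic.leadingCoeff]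
      exact_mod_cast hp.out.not_dvd_one
    · have h := hE.mem (n := j) (by rw [hdeg]; exact hj)
      exact Ideal.mem_span_singleton.mp h
    · have h := hE.notMem
      rw [Ideal.span_singleton_pow, Ideal.mem_span_singleton] at h
      exact h
  -- undo the substitution `X ↦ X + 1`
  have hmap : f.map (Int.castRingHom ℚ_[p]) = (cyclotomic p ℚ_[p]).comp (X + 1) := by
    rw [hf, map_comp, map_cyclotomic, Polynomial.map_add, map_X, Polynomial.map_one]
  rw [hmap] at hirr
  have hcomp : (cyclotomic p ℚ_[p]).comp (X + 1) =
      algEquivAevalXAddC (1 : ℚ_[p]) (cyclotomic p ℚ_[p]) := by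
    rw [algEquivAevalXAddC_apply, ← comp_eq_aeval, map_one]
  rw [hcomp] at hirr
  exact (MulEquiv.irreducible_iff (algEquivAevalXAddC (1 : ℚ_[p])).toMulEquiv).mp hirr

/-- **No primitive `p`-th root of unity `ζ ∈ ℚ̄_p` (`p ≥ 5`) is moved by `Γ_{ℚ_p} = Gal(ℚ̄_p/ℚ_p)`
only within `{ζ, ζ⁻¹}`**: otherwise `ζ + ζ⁻¹ ∈ ℚ_p` (Galois descent in `ℚ̄_p`), so `ζ` is a root of
a quadratic over `ℚ_p`, whereas its minimal polynomial `Φ_p` has degree `p - 1 ≥ 4`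
(`irreducible_cyclotomic_padic`). [cite: SerreLocalFields1979, IV.§4 Prop. 17] -/
theorem false_of_isPrimitiveRoot_of_forall_smul (p : ℕ) [hp : Fact p.Prime] (hp5 : 5 ≤ p)
    {ζ : AlgebraicClosure ℚ_[p]} (hζ : IsPrimitiveRoot ζ p)
    (h : ∀ σ : Field.absoluteGaloisGroup ℚ_[p], σ • ζ = ζ ∨ σ • ζ = ζ ^ (p - 1)) : False := by
  have hp2 : 2 ≤ p := hp.out.two_le
  set η : AlgebraicClosure ℚ_[p] := ζ + ζ ^ (p - 1) with hη
  have hζp : ζ ^ p = 1 := hζ.pow_eq_one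
  have hpow : (ζ ^ (p - 1)) ^ (p - 1) = ζ := by
    rw [← pow_mul]
    have : (p - 1) * (p - 1) = p * (p - 2) + 1 := by
      obtain ⟨k, hk⟩ : ∃ k, p = k + 2 := ⟨p - 2, by omega⟩
      rw [hk, show k + 2 - 1 = k + 1 by omega, show k + 2 - 2 = k by omega]
      ring
    rw [this, pow_add, pow_mul, hζp, one_pow, one_mul, pow_one]
  -- `η` is fixed by `Γ_{ℚ_p}`
  have hfix : ∀ σ : Field.absoluteGaloisGroup ℚ_[p], σ • η = η := by
    intro σ
    rw [hη, smul_add, smul_pow']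
    rcases h σ with hσ | hσ
    · rw [hσ]
    · rw [hσ, hpow, add_comm]
  -- hence rational over `ℚ_p`
  haveI : IsGalois ℚ_[p] (AlgebraicClosure ℚ_[p]) := IsAlgClosure.isGalois ℚ_[p] _
  obtain ⟨c, hc⟩ : η ∈ Set.range (algebraMap ℚ_[p] (AlgebraicClosure ℚ_[p])) :=
    (InfiniteGalois.mem_range_algebraMap_iff_fixed η).mpr fun σ ↦
      hfix ((Field.absoluteGaloisGroup.toAlgEquiv ℚ_[p]).symm σ)
  -- `ζ` is a root of `X² - c X + 1`
  set g : ℚ_[p][X] := X ^ 2 - C c * X + 1 with hg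
  have hgζ : aeval ζ g = 0 := by
    have e1 : aeval ζ g = ζ ^ 2 - η * ζ + 1 := by
      rw [hg, map_add, map_sub, map_mul, aeval_C, hc, map_pow, aeval_X, map_one]
    have : ζ * ζ ^ (p - 1) = 1 := by rw [← pow_succ', Nat.sub_add_cancel (by omega), hζp]
    rw [e1, hη]
    linear_combination -this
  have hg0 : g ≠ 0 := fun h0 ↦ by simpa [hg] using congrArg (eval (0 : ℚ_[p])) h0
  have hgdeg : g.natDegree ≤ 2 := by
    rw [hg]
    have : (X ^ 2 - C c * X + 1 : ℚ_[p][X]) = X ^ 2 + (C (-c) * X + C 1) := by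
      simp only [map_neg, neg_mul, map_one]; ring
    rw [this]
    refine (natDegree_add_le _ _).trans (max_le (by rw [natDegree_X_pow]) ?_)
    refine (natDegree_add_le _ _).trans (max_le ?_ (by rw [natDegree_C]; omega))
    exact (natDegree_C_mul_le _ _).trans (by rw [natDegree_X]; omega)
  -- the minimal polynomial of `ζ` is `Φ_p`, of degree `p - 1`
  haveI : NeZero (p : AlgebraicClosure ℚ_[p]) := NeZero.charZero
  have hmin : minpoly ℚ_[p] ζ = cyclotomic p ℚ_[p] := by
    refine (minpoly.eq_of_irreducible_of_monic (irreducible_cyclotomic_padic p) ?_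
      (cyclotomic.monic p _)).symm
    rw [aeval_def, eval₂_eq_eval_map, map_cyclotomic]
    exact isRoot_cyclotomic_iff.mpr hζ
  have hdvd : minpoly ℚ_[p] ζ ∣ g := minpoly.dvd ℚ_[p] ζ hgζ
  have hle : (minpoly ℚ_[p] ζ).natDegree ≤ g.natDegree := natDegree_le_of_dvd hdvd hg0
  rw [hmin, natDegree_cyclotomic, Nat.totient_prime hp.out] at hle
  omega

/-- **Two independent points span a group of order `p²`**: in an additive group of order `p²`, if
`a ≠ 0` is killed by the prime `p` and `b ∉ ℤa`, then every element is `m • a + n • b`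
(`G/ℤa` has prime order `p`, so the image of `b` generates it). [folklore] -/
theorem exists_zsmul_add_zsmul_of_card_eq_sq {G : Type*} [AddCommGroup G] {p : ℕ} [hp : Fact p.Prime]
    (hG : Nat.card G = p ^ 2) {a b : G} (ha0 : a ≠ 0) (hpa : p • a = 0)
    (hb : b ∉ AddSubgroup.zmultiples a) (x : G) : ∃ m n : ℤ, x = m • a + n • b := by
  have hord : addOrderOf a = p := addOrderOf_eq_prime hpa ha0
  set H : AddSubgroup G := AddSubgroup.zmultiples a with hH
  have hcardH : Nat.card H = p := by rw [hH, Nat.card_zmultiples, hord]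
  have hcardQ : Nat.card (G ⧸ H) = p := by
    have h := H.card_eq_card_quotient_mul_card_addSubgroup
    rw [hG, hcardH, pow_two] at h
    exact (Nat.eq_of_mul_eq_mul_right hp.out.pos h).symm
  have hb' : (QuotientAddGroup.mk b : G ⧸ H) ≠ 0 := fun h ↦
    hb ((QuotientAddGroup.eq_zero_iff b).mp h)
  have hx : (QuotientAddGroup.mk x : G ⧸ H) ∈ AddSubgroup.zmultiples (QuotientAddGroup.mk b : G ⧸ H) :=
    mem_zmultiples_of_prime_card hcardQ hb'
  obtain ⟨n, hn⟩ := AddSubgroup.mem_zmultiples_iff.mp hx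
  have hmem : x - n • b ∈ H := by
    rw [← QuotientAddGroup.eq_zero_iff, QuotientAddGroup.mk_sub, QuotientAddGroup.mk_zsmul, hn,
      sub_self]
  obtain ⟨m, hm⟩ := AddSubgroup.mem_zmultiples_iff.mp hmem
  exact ⟨m, n, by rw [hm, sub_add_cancel]⟩

/-- **A `ℚ_p`-rational `n`-torsion point as a geometric torsion point fixed by the decomposition group.** For
`W/ℚ` elliptic and `P ∈ W(ℚ_p)` with `n • P = 0` (`n ≠ 0`) there is `P₀ ∈ W[n](ℚ̄)` whose image in `W(ℚ̄_p)`
(`pointsMap`) is `P`, fixed by `resGal σ` for every `σ ∈ Γ_{ℚ_p}`, and non-zero if `P` is (all torsion of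
`W(ℚ̄_p)` is algebraic: `torsionPointsEquiv`; Galois descent over `ℚ_p`). [cite: SilvermanAEC2009, Cor. III.6.4(b) and VIII.§1] -/
theorem exists_geomTorsion_of_padicPoint (W : WeierstrassCurve ℚ) [W.IsElliptic] (p : ℕ)
    [Fact p.Prime] {n : ℤ} (hn : n ≠ 0) (P : (W.baseChange ℚ_[p]).toAffine.Point) (hP : n • P = 0) :
    ∃ P₀ : geomTorsion W n,
      pointsMap W ℚ_[p] (P₀ : W.geomPoints) =
        W.baseChangeGeomPointsEquiv ℚ_[p] (toGeomPoints (W.baseChange ℚ_[p]) P) ∧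
      (∀ σ : absoluteGaloisGroup ℚ_[p], resGal (K := ℚ) ℚ_[p] σ • P₀ = P₀) ∧
      (P ≠ 0 → P₀ ≠ 0) := by
  set ι : (W.baseChange ℚ_[p]).toAffine.Point →+ localPoints W ℚ_[p] :=
    (W.baseChangeGeomPointsEquiv ℚ_[p]).toAddMonoidHom.comp (toGeomPoints (W.baseChange ℚ_[p]))
    with hι
  have hιinj : Function.Injective ι :=
    (W.baseChangeGeomPointsEquiv ℚ_[p]).injective.comp (toGeomPoints_injective _)
  have hfix : ∀ (τ : absoluteGaloisGroup ℚ_[p]), τ • ι P = ι P := fun τ ↦ by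
    change τ • W.baseChangeGeomPointsEquiv ℚ_[p] (toGeomPoints (W.baseChange ℚ_[p]) P) =
      W.baseChangeGeomPointsEquiv ℚ_[p] (toGeomPoints (W.baseChange ℚ_[p]) P)
    rw [← baseChangeGeomPointsEquiv_smul, smul_toGeomPoints]
  have hιP : n • ι P = 0 := by rw [← map_zsmul, hP, map_zero]
  set T : AddSubgroup.torsionBy (localPoints W ℚ_[p]) n := ⟨ι P, (Submodule.mem_torsionBy_iff _ _).mpr hιP⟩
    with hT
  set θ := W.torsionPointsEquiv n (E := ℚ_[p]) hn with hθ
  refine ⟨θ.symm T, ?_, fun σ ↦ ?_, fun hP0 h0 ↦ ?_⟩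
  · rw [hθ, pointsMap_torsionPointsEquiv_symm]
    rfl
  · rw [hθ, ← torsionPointsEquiv_symm_smul]
    congr 1
    exact Subtype.ext (hfix σ)
  · have h1 : pointsMap W ℚ_[p] ((θ.symm T : geomTorsion W n) : W.geomPoints) = ι P := by
      rw [hθ, pointsMap_torsionPointsEquiv_symm]
    rw [h0, ZeroMemClass.coe_zero, map_zero] at h1
    exact hP0 (hιinj (by rw [map_zero]; exact h1.symm))


/-- **Every `n`-torsion point of `W(ℚ̄_p)` is algebraic, with the expected Galois action**: for `R ∈ W(ℚ̄_p)`,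
`n • R = 0` (`n ≠ 0`), there is `R₀ ∈ W[n](ℚ̄)` mapping to `R`, and `σ • R` is the image of `resGal σ • R₀`
(`torsionPointsEquiv`, `pointsMap_smul`). [cite: SilvermanAEC2009, Cor. III.6.4(b)] -/
theorem exists_geomTorsion_of_localPoint (W : WeierstrassCurve ℚ) [W.IsElliptic] (p : ℕ)
    [Fact p.Prime] {n : ℤ} (hn : n ≠ 0) (R : localPoints W ℚ_[p]) (hR : n • R = 0) :
    ∃ R₀ : geomTorsion W n, pointsMap W ℚ_[p] (R₀ : W.geomPoints) = R ∧
      ∀ σ : absoluteGaloisGroup ℚ_[p],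
        σ • R = pointsMap W ℚ_[p] ((resGal (K := ℚ) ℚ_[p] σ • R₀ : geomTorsion W n) : W.geomPoints) := by
  set θ := W.torsionPointsEquiv n (E := ℚ_[p]) hn with hθ
  set T : AddSubgroup.torsionBy (localPoints W ℚ_[p]) n := ⟨R, (Submodule.mem_torsionBy_iff _ _).mpr hR⟩
  refine ⟨θ.symm T, by rw [hθ, pointsMap_torsionPointsEquiv_symm], fun σ ↦ ?_⟩
  rw [AddSubgroup.torsionBy.coe_smul, pointsMap_smul, hθ, pointsMap_torsionPointsEquiv_symm]

end Summit.BirchSwinnertonDyer.BirchSwinnertonDyer.Theorems.TorsTwist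

end
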